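import Literature.Probability.RandomPlanarGeometry.HexSAWStripSurfaceGrowth
import Mathlib.Analysis.SpecialFunctions.Pow.Continuity
import Mathlib.Analysis.SpecialFunctions.Sqrt
import HarnessLib

/-!
# `ν_T(λy) ≤ √λ · ν_T(y)`: the top level is visited at most every other step (BBdGDCG14, Proposition 6 — the sharp one-sided modulus)

Topic `Literature/Probability/RandomPlanarGeometry` (rider on `HexSAWStripSurfaceGrowth.lean`:
`HV.stripChains`, `HV.topCnt`, `HV.stripZL`, `HV.stripNu`, `HV.tendsto_stripZL_rpow`, `HV.stripNu_mono_y`; uses `HV.lev_eq_of_adj` of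
`HexSAWStrip.lean`: along an edge of `ℍ` the level changes by `±1`).  Source frame: N. R. Beaton, M. Bousquet-Mélou, J. de Gier,
H. Duminil-Copin, A. J. Guttmann, *The critical fugacity for surface adsorption of self-avoiding walks on the honeycomb lattice is `1 + √2`*,
Comm. Math. Phys. 326 (2014), arXiv:1109.0358v5, §3.2 Proposition 6 (p. 10: "non-decreasing in `y`", "continuous function of `log y`") and
§2 (p. 4: the surface weight sits on the vertices of the top row — on the honeycomb lattice two consecutive vertices of a walk are never
both on one level).

## What is proved (namespace `Literature.Probability.RandomPlanarGeometry.SAW.HV`; `T ≥ 1`)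

* `topCnt_le_half` — a self-avoiding chain of `S_T` with `n + 1` vertices has at most `(n + 2)/2` vertices on the top level
  (levels move by `±1` per step and the top level is the maximal one, so no two consecutive vertices are both on it);
* `stripZL_scale_le_sqrt` — `Z_n(λy) ≤ λ^{(n+2)/2} Z_n(y)` (`λ ≥ 1`, `y ≥ 0`);
* ★ **`stripNu_scale_le_sqrt`** — `ν_T(λy) ≤ √λ · ν_T(y)` (`λ ≥ 1`, `y > 0`): the tree's modulus `ν_T(λy) ≤ λ ν_T(y)`
  (`stripNu_scale_le`) sharpened to the exponent `1/2`; `stripNu_div_sqrt_antitone` — `y ↦ ν_T(y)/√y` is non-increasing on `(0,∞)`;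
* `topZigzag`, `topZigzag_mem`, `topCnt_topZigzag`, `pow_half_le_stripZL` and ★ **`sqrt_le_stripNu`** — `√y ≤ ν_T(y)` for every `y > 0`
  (Corollary 8's proof, p. 12: "μ_T(1,y) ≥ √y (as can be seen by counting zig-zag paths)", HV frame; so `ν_T(y)/√y ∈ [1, ν_T(1)]` for `y ≥ 1`).

Label: lane corollary XS (the half-density parity for the strip rate; the half-plane twin is the lane's «WALL-RATE SQRT-MONOTONE»).
Lane «pcv-sawmu», a-p2 g12, 2026-08-24 (suggested by a-ref-1 g48's face note 01:58:40Z; edition 2: + the top zigzag and `√y ≤ ν_T(y)`).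
-/

noncomputable section

open Finset Filter Topology

namespace Literature.Probability.RandomPlanarGeometry.SAW.HV

variable {T : ℕ}

/-! ### No two consecutive top-level vertices -/

/-- Counting lemma: along a chain of `ℍ` whose levels stay `≤ 2T − 1`, at most every other vertex is on the level `2T − 1`
(the level moves by `±1` per step): `2 · #top ≤ length + 1`. [folklore] -/
private theorem two_mul_topCnt_le_aux (T : ℕ) :
    ∀ (l : List HV), l.IsChain hvGraph.Adj → (∀ v ∈ l, lev v ≤ 2 * (T : ℤ) - 1) → 2 * topCnt T l ≤ l.length + 1
  | [], _, _ => by simp [topCnt]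
  | [a], _, _ => by
    rw [topCnt_singleton]
    split_ifs <;> simp
  | a :: b :: l, hc, hlev => by
    rw [List.isChain_cons_cons] at hc
    obtain ⟨hab, hbl⟩ := hc
    have hlevbl : ∀ v ∈ b :: l, lev v ≤ 2 * (T : ℤ) - 1 := fun v hv => hlev v (List.mem_cons_of_mem a hv)
    have hlevl : ∀ v ∈ l, lev v ≤ 2 * (T : ℤ) - 1 := fun v hv => hlevbl v (List.mem_cons_of_mem b hv)
    have hcl : l.IsChain hvGraph.Adj := by
      cases l with
      | nil => exact List.IsChain.nil
      | cons c l' => exact (List.isChain_cons_cons.1 hbl).2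
    have ih1 := two_mul_topCnt_le_aux T (b :: l) hbl hlevbl
    have ih2 := two_mul_topCnt_le_aux T l hcl hlevl
    rw [topCnt_cons] at ih1 ⊢
    rw [topCnt_cons]
    have hla := hlev a (by simp)
    have hlb := hlev b (by simp)
    simp only [List.length_cons] at ih1 ih2 ⊢
    by_cases ha : lev a = 2 * (T : ℤ) - 1
    · -- then `b` is one level below the top
      have hb : ¬ lev b = 2 * (T : ℤ) - 1 := by
        rcases lev_eq_of_adj hab with h | h <;> omega
      rw [if_pos ha, if_neg hb]
      omega
    · rw [if_neg ha]
      omega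

/-- **At most every other vertex of a strip chain is on the top level**: `2 · topCnt T ω ≤ n + 2` for `ω ∈ stripChains T n`
(the level changes by `±1` along each edge, and `2T − 1` is the highest level of `S_T`).
[cite: BeatonBousquetMelouDeGierDuminilCopinGuttmann2014, §2 (arXiv v5 p. 4: weight y per vertex of the top row); DuminilCopinSmirnov2012, §3 (the levels of S_T)] -/
theorem two_mul_topCnt_le {n : ℕ} {l : List HV} (hl : l ∈ stripChains T n) : 2 * topCnt T l ≤ n + 2 := by
  obtain ⟨hchain, -, hlen, -, hin⟩ := mem_stripChains_iff.1 hl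
  have h := two_mul_topCnt_le_aux T l hchain fun v hv => (hin v hv).2
  omega

/-! ### The `√λ` modulus -/

/-- **`Z_n(λy) ≤ λ^{(n+2)/2} · Z_n(y)`** for `λ ≥ 1`, `y ≥ 0` (at most `(n+2)/2` weighted vertices).
[cite: BeatonBousquetMelouDeGierDuminilCopinGuttmann2014, Proposition 6 (arXiv v5 p. 10); lane: half-density sharpening of `stripZL_scale_le`] -/
theorem stripZL_scale_le_sqrt (T n : ℕ) {y c : ℝ} (hy : 0 ≤ y) (hc : 1 ≤ c) :
    stripZL T n (c * y) ≤ c ^ ((n + 2) / 2) * stripZL T n y := by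
  rw [stripZL, stripZL, mul_sum]
  refine sum_le_sum fun l hl => ?_
  have hk : topCnt T l ≤ (n + 2) / 2 := by have := two_mul_topCnt_le hl; omega
  rw [mul_pow]
  exact mul_le_mul_of_nonneg_right (pow_le_pow_right₀ hc hk) (pow_nonneg hy _)

/-- ★ **`ν_T(λy) ≤ √λ · ν_T(y)`** for `λ ≥ 1`, `y > 0` (`n`-th roots of `stripZL_scale_le_sqrt`, `(λ^{(n+2)/2})^{1/n} → √λ`).
[cite: BeatonBousquetMelouDeGierDuminilCopinGuttmann2014, Proposition 6 (arXiv v5 p. 10: μ_T(1,y) is continuous in log y); lane: the sharp one-sided modulus] -/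
theorem stripNu_scale_le_sqrt (hT : 1 ≤ T) {y c : ℝ} (hy : 0 < y) (hc : 1 ≤ c) :
    stripNu T (c * y) ≤ Real.sqrt c * stripNu T y := by
  have hc0 : 0 < c := by linarith
  have hcy : 0 < c * y := mul_pos hc0 hy
  -- compare n-th roots: Z_n(cy)^{1/n} ≤ (c^{(n+2)/2})^{1/n} · Z_n(y)^{1/n}, and (c^{(n+2)/2})^{1/n} → √c
  have hlim : Tendsto (fun n : ℕ => ((c ^ ((n + 2) / 2) : ℝ)) ^ (1 / (n : ℝ))) atTop (𝓝 (Real.sqrt c)) := by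
    -- squeeze between c^{1/2} and c^{1/2 + 1/n}: (n+2)/2 ∈ {n/2, n/2 + 1} as naturals; use real exponents
    have h1 : ∀ n : ℕ, 1 ≤ n → Real.sqrt c ≤ ((c ^ ((n + 2) / 2) : ℝ)) ^ (1 / (n : ℝ)) := by
      intro n hn
      have hn0 : (0 : ℝ) < n := by exact_mod_cast hn
      rw [Real.sqrt_eq_rpow, ← Real.rpow_natCast, ← Real.rpow_mul hc0.le]
      refine Real.rpow_le_rpow_of_exponent_le hc ?_
      rw [mul_one_div, le_div_iff₀ hn0]
      have : (n : ℝ) ≤ 2 * (((n + 2) / 2 : ℕ) : ℝ) := by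
        have h : n ≤ 2 * ((n + 2) / 2) := by omega
        exact_mod_cast h
      linarith
    have h2 : ∀ n : ℕ, 1 ≤ n → ((c ^ ((n + 2) / 2) : ℝ)) ^ (1 / (n : ℝ)) ≤ c ^ ((1 : ℝ) / 2 + 1 / (n : ℝ)) := by
      intro n hn
      have hn0 : (0 : ℝ) < n := by exact_mod_cast hn
      rw [← Real.rpow_natCast, ← Real.rpow_mul hc0.le]
      refine Real.rpow_le_rpow_of_exponent_le hc ?_
      rw [mul_one_div, div_le_iff₀ hn0, add_mul, one_div_mul_cancel hn0.ne']
      have : (((n + 2) / 2 : ℕ) : ℝ) ≤ (n : ℝ) / 2 + 1 := by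
        have h : 2 * ((n + 2) / 2) ≤ n + 2 := Nat.mul_div_le (n + 2) 2
        have h' : (2 : ℝ) * (((n + 2) / 2 : ℕ) : ℝ) ≤ (n : ℝ) + 2 := by exact_mod_cast h
        linarith
      nlinarith
    have hup : Tendsto (fun n : ℕ => c ^ ((1 : ℝ) / 2 + 1 / (n : ℝ))) atTop (𝓝 (Real.sqrt c)) := by
      have ht : Tendsto (fun n : ℕ => (1 : ℝ) / 2 + 1 / (n : ℝ)) atTop (𝓝 ((1 : ℝ) / 2)) := by
        simpa using (tendsto_const_nhds (x := (1 : ℝ) / 2)).add tendsto_one_div_atTop_nhds_zero_nat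
      have := (tendsto_const_nhds (x := c)).rpow ht (Or.inl hc0.ne')
      rw [Real.sqrt_eq_rpow]
      exact this
    refine tendsto_of_tendsto_of_tendsto_of_le_of_le' tendsto_const_nhds hup ?_ ?_
    · filter_upwards [eventually_ge_atTop 1] with n hn using h1 n hn
    · filter_upwards [eventually_ge_atTop 1] with n hn using h2 n hn
  have hprod := hlim.mul (tendsto_stripZL_rpow hT hy)
  refine le_of_tendsto_of_tendsto' (tendsto_stripZL_rpow hT hcy) hprod fun n => ?_
  have hZ := stripZL_nonneg T n hy.le
  rw [← Real.mul_rpow (pow_nonneg hc0.le _) hZ]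
  exact Real.rpow_le_rpow (stripZL_nonneg T n hcy.le) (stripZL_scale_le_sqrt T n hy.le hc) (by positivity)

/-- **`y ↦ ν_T(y)/√y` is non-increasing on `(0, ∞)`.** [cite: BeatonBousquetMelouDeGierDuminilCopinGuttmann2014, Proposition 6 (arXiv v5 p. 10); lane corollary] -/
theorem stripNu_div_sqrt_antitone (hT : 1 ≤ T) {y y' : ℝ} (hy : 0 < y) (hyy' : y ≤ y') :
    stripNu T y' / Real.sqrt y' ≤ stripNu T y / Real.sqrt y := by
  have hy' : 0 < y' := hy.trans_le hyy'
  have hc : 1 ≤ y' / y := (one_le_div hy).2 hyy'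
  have h := stripNu_scale_le_sqrt hT hy hc
  rw [div_mul_cancel₀ y' hy.ne'] at h
  have hsy : 0 < Real.sqrt y := Real.sqrt_pos.2 hy
  have hsy' : 0 < Real.sqrt y' := Real.sqrt_pos.2 hy'
  rw [div_le_div_iff₀ hsy' hsy]
  calc stripNu T y' * Real.sqrt y ≤ Real.sqrt (y' / y) * stripNu T y * Real.sqrt y := mul_le_mul_of_nonneg_right h hsy.le
    _ = stripNu T y * Real.sqrt y' := by
        rw [Real.sqrt_div' y' hy.le]  -- hmm
        field_simp

/-! ### The top zigzag: `ν_T(y) ≥ √y` -/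

/-- The zigzag `(⌊i/2⌋, T − 1, [i odd])`, `i = 0, …, n`, along the two TOP levels `2T − 2`, `2T − 1` of `S_T`.
[cite: BeatonBousquetMelouDeGierDuminilCopinGuttmann2014, Corollary 8, proof (arXiv v5 p. 12: "μ_T(1,y) ≥ √y (as can be seen by counting zig-zag paths …)")] -/
def topZigzag (T n : ℕ) : List HV :=
  (List.range (n + 1)).map fun i => (((i / 2 : ℕ) : ℤ), ((T : ℤ) - 1), decide (i % 2 = 1))

/-- The top zigzag is an `n`-step self-avoiding list of `S_T` with standard head (`T ≥ 1`).
[cite: BeatonBousquetMelouDeGierDuminilCopinGuttmann2014, Corollary 8, proof (arXiv v5 p. 12: zig-zag paths)] -/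
theorem topZigzag_mem (hT : 1 ≤ T) (n : ℕ) : topZigzag T n ∈ stripChains T n := by
  rw [mem_stripChains_iff]
  refine ⟨?_, ?_, by simp [topZigzag], ⟨(0, (T : ℤ) - 1, false), by simp [topZigzag, List.range_succ_eq_map], rfl⟩, ?_⟩
  · rw [topZigzag, List.isChain_map, List.isChain_range_succ]
    intro m _
    rcases Nat.even_or_odd m with ⟨k, hk⟩ | ⟨k, hk⟩
    · have e1 : m / 2 = k := by omega
      have e2 : (m + 1) / 2 = k := by omega
      have e3 : decide (m % 2 = 1) = false := decide_eq_false (by omega)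
      have e4 : decide ((m + 1) % 2 = 1) = true := decide_eq_true (by omega)
      rw [Nat.succ_eq_add_one, e1, e2, e3, e4]
      simp [hvGraph_adj, AdjRel]
    · have e1 : m / 2 = k := by omega
      have e2 : (m + 1) / 2 = k + 1 := by omega
      have e3 : decide (m % 2 = 1) = true := decide_eq_true (by omega)
      have e4 : decide ((m + 1) % 2 = 1) = false := decide_eq_false (by omega)
      rw [Nat.succ_eq_add_one, e1, e2, e3, e4]
      simp [hvGraph_adj, AdjRel]
  · rw [topZigzag]
    refine (List.nodup_range).map_on fun i _ j _ h => ?_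
    simp only [Prod.mk.injEq, Nat.cast_inj, decide_eq_decide] at h
    omega
  · intro v hv
    rw [topZigzag, List.mem_map] at hv
    obtain ⟨i, -, rfl⟩ := hv
    by_cases h : i % 2 = 1
    · rw [decide_eq_true h]; simp; omega
    · rw [decide_eq_false h]; simp; omega

/-- The top zigzag visits the top level at its odd positions: `topCnt T (topZigzag T n) = (n + 1)/2`.
[cite: BeatonBousquetMelouDeGierDuminilCopinGuttmann2014, Corollary 8, proof (arXiv v5 p. 12: zig-zag paths)] -/
theorem topCnt_topZigzag (T n : ℕ) : topCnt T (topZigzag T n) = (n + 1) / 2 := by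
  rw [topCnt, topZigzag, ← List.countP_eq_length_filter, List.countP_map]
  have hfun : ((fun v : HV => decide (lev v = 2 * (T : ℤ) - 1)) ∘
      (fun i : ℕ => (((i / 2 : ℕ) : ℤ), ((T : ℤ) - 1), decide (i % 2 = 1)))) = fun i : ℕ => decide (i % 2 = 1) := by
    funext i
    simp only [Function.comp_apply]
    by_cases h : i % 2 = 1
    · rw [decide_eq_true h]; simp; try omega
    · rw [decide_eq_false h]; simp; try omega
  rw [hfun]
  have key : ∀ N : ℕ, (List.range N).countP (fun i : ℕ => decide (i % 2 = 1)) = N / 2 := by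
    intro N
    induction N with
    | zero => simp
    | succ N ih =>
      rw [List.range_succ, List.countP_append, ih]
      simp only [List.countP_cons, List.countP_nil, decide_eq_true_eq, zero_add]
      split_ifs with h <;> omega
  rw [key]

/-- `y^{(n+1)/2} ≤ Z_n(y)` for `y ≥ 0`, `T ≥ 1` (the top zigzag alone). [cite: BeatonBousquetMelouDeGierDuminilCopinGuttmann2014, Corollary 8, proof (arXiv v5 p. 12)] -/
theorem pow_half_le_stripZL (hT : 1 ≤ T) (n : ℕ) {y : ℝ} (hy : 0 ≤ y) : y ^ ((n + 1) / 2) ≤ stripZL T n y := by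
  have h := single_le_sum (f := fun l => y ^ topCnt T l) (fun _ _ => pow_nonneg hy _) (topZigzag_mem hT n)
  rwa [topCnt_topZigzag] at h

/-- ★ **`√y ≤ ν_T(y)`** for every `y > 0`, `T ≥ 1` — "μ_T(1,y) ≥ √y (as can be seen by counting zig-zag paths)", for the HV-frame
rate (so `ρ_T(y) = 1/ν_T(y) ≤ 1/√y → 0`). [cite: BeatonBousquetMelouDeGierDuminilCopinGuttmann2014, Corollary 8, proof (arXiv v5 p. 12, verbatim clause)] -/
theorem sqrt_le_stripNu (hT : 1 ≤ T) {y : ℝ} (hy : 0 < y) : Real.sqrt y ≤ stripNu T y := by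
  -- (y^{(n+1)/2})^{1/n} = y^{((n+1)/2)/n} → y^{1/2} = √y
  have hlim : Tendsto (fun n : ℕ => (y ^ ((n + 1) / 2) : ℝ) ^ (1 / (n : ℝ))) atTop (𝓝 (Real.sqrt y)) := by
    have he : Tendsto (fun n : ℕ => ((((n + 1) / 2 : ℕ) : ℝ)) * (1 / (n : ℝ))) atTop (𝓝 ((1 : ℝ) / 2)) := by
      -- squeeze: (n - 1)/(2n) ≤ ⌊(n+1)/2⌋/n ≤ (n+1)/(2n)
      have hlo : Tendsto (fun n : ℕ => ((1 : ℝ) / 2 - 1 / (2 * (n : ℝ)))) atTop (𝓝 ((1 : ℝ) / 2)) := by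
        have : Tendsto (fun n : ℕ => 1 / (2 * (n : ℝ))) atTop (𝓝 0) := by
          have h := tendsto_one_div_atTop_nhds_zero_nat.const_mul ((1 : ℝ) / 2)
          rw [mul_zero] at h
          refine h.congr fun n => ?_
          field_simp
        simpa using (tendsto_const_nhds (x := (1 : ℝ) / 2)).sub this
      have hhi : Tendsto (fun n : ℕ => ((1 : ℝ) / 2 + 1 / (2 * (n : ℝ)))) atTop (𝓝 ((1 : ℝ) / 2)) := by
        have : Tendsto (fun n : ℕ => 1 / (2 * (n : ℝ))) atTop (𝓝 0) := by
          have h := tendsto_one_div_atTop_nhds_zero_nat.const_mul ((1 : ℝ) / 2)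
          rw [mul_zero] at h
          refine h.congr fun n => ?_
          field_simp
        simpa using (tendsto_const_nhds (x := (1 : ℝ) / 2)).add this
      refine tendsto_of_tendsto_of_tendsto_of_le_of_le' hlo hhi ?_ ?_
      · filter_upwards [eventually_ge_atTop 1] with n hn
        have hn0 : (0 : ℝ) < n := by exact_mod_cast hn
        have h2 : (n : ℝ) - 1 ≤ 2 * ((((n + 1) / 2 : ℕ) : ℝ)) := by
          have : n - 1 ≤ 2 * ((n + 1) / 2) := by omega
          have h' : ((n - 1 : ℕ) : ℝ) ≤ ((2 * ((n + 1) / 2) : ℕ) : ℝ) := by exact_mod_cast this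
          rw [Nat.cast_sub hn] at h'
          push_cast at h'
          linarith
        rw [mul_one_div, le_div_iff₀ hn0]
        have e : (1 / 2 - 1 / (2 * (n : ℝ))) * n = ((n : ℝ) - 1) / 2 := by field_simp
        rw [e, div_le_iff₀ (by norm_num : (0 : ℝ) < 2)]
        linarith
      · filter_upwards [eventually_ge_atTop 1] with n hn
        have hn0 : (0 : ℝ) < n := by exact_mod_cast hn
        have h2 : 2 * ((((n + 1) / 2 : ℕ) : ℝ)) ≤ (n : ℝ) + 1 := by
          have : 2 * ((n + 1) / 2) ≤ n + 1 := Nat.mul_div_le (n + 1) 2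
          exact_mod_cast this
        rw [mul_one_div, div_le_iff₀ hn0]
        have e : (1 / 2 + 1 / (2 * (n : ℝ))) * n = ((n : ℝ) + 1) / 2 := by field_simp
        rw [e, le_div_iff₀ (by norm_num : (0 : ℝ) < 2)]
        linarith
    have h := (tendsto_const_nhds (x := y)).rpow he (Or.inl hy.ne')
    rw [← Real.sqrt_eq_rpow] at h
    refine h.congr fun n => ?_
    rw [← Real.rpow_natCast, ← Real.rpow_mul hy.le]
  exact le_of_tendsto_of_tendsto' hlim (tendsto_stripZL_rpow hT hy) fun n =>
    Real.rpow_le_rpow (pow_nonneg hy.le _) (pow_half_le_stripZL hT n hy.le) (by positivity)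

end Literature.Probability.RandomPlanarGeometry.SAW.HV
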